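import Mathlib
import HarnessLib
import Summits.HubbardSuperconductivity.HubbardSuperconductivity.Theorems.KLProgrammeKLRegimeEngineTowerRemeasureLev
import Summits.HubbardSuperconductivity.HubbardSuperconductivity.Theorems.KLProgrammeH10TwoPointLimitKlAnisoAbsUmklappCountWindow

/-!
# Route `KLProgramme` — crux K3 ENGINE (stmt-HubbardSuperconductivity-20437 `KLRegimeEngineV17F2`), stub (b) v2, THE LEVELS PACKAGE (ℓ), instantiation (I2),
# THE JUMP HALF WITH THE SECOND CONSERVATION GAIN — the scale-`0` action re-measured at `F_{J′}` is at most `C_m·(2^{J′})^{(m+1) − max(F,1) − 2}` times the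
# level-`F` carriers (located item «UV-REMEASURE-COUNT», decision (b) «COUNTING», count «ABS-UMK-COUNT»)

Cell gate-hubbard-kl, seat p4 g16 (count side; the consumer-side twin OFFERED to the k3c2-p3 / E1 lineages, memo HOME/prover-p4/UV-REMEASURE-COUNT.md §2, §4).
k3c2-p3's `EngineV8.klLevNormOf_jump_le_of_consts` (…EngineTowerRemeasureLev §2) pays the relative count with the prescribed legs fixed and ONE further leg
determined by conservation (`hcnt`, exponent `(m+1) − |E| − 1`); for the `k′ = 0` summand of `(Hμ)` (the scale-`0` action `𝒱_0` re-measured at `F_{dk−1}`) this is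
flat against E1's allowance at every degree (UV-REMEASURE-COUNT §2).  This file runs the SAME re-sectorisation (`hubbardSectorPrescribedSum_klAniso_jump_le_split`
with the empty on-class set) on the ABSOLUTE count with the second conservation gain, `PerturbedFermiCurve.card_relCount_prescribed_absUmklapp_klAniso_le_window`
(exponent `(m+1) − |E| − 2`, umklapp strings included, `|E| + 5 ≤ m + 1`):

* `legSet_count_arith_abs` — `27^e · (D^{m+1}·(2^{J′})^{(m+1)−e−2}) ≤ D^{m+1}·27^{m+1}·(2^{J′})^{(m+1) − max(F,1) − 2}` for `max(F,1) ≤ e ≤ m + 1`;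
* **`klLevNormOf_jump_le_of_consts_abs`** — the levelled jump at abstract overlap constants with the absolute count: for `levelCount Ωe + 6 ≤ m + 1`,
  `klLevNormOf … J′ (m+1) T Ωe ≤ c₁^m·c₁r·ε^{m+1}·(D^{m+1}·27^{m+1})·(2^{J′})^{(m+1) − max(levelCount Ωe, 1) − 2}·N` — exponent `(L−3)` for the plain norm (`F = 0`) and
  `(L − F − 2)` at level `F ≥ 1` (the pinned leg of the `L¹–L^∞` norm may be a prescribed one);
* **`klLevNormOf_jump_le_klEng_abs`** — the same with the constants DISCHARGED under the binders of `stub_engine_step_norms` (as `klLevNormOf_jump_le_klEng`);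
* **`klLevNormOf_scaleZero_remeasure_le_klEng_abs`** — THE SCALE-`0` ACTION `𝒱_0[K]` RE-MEASURED AT `F_{J′}` (`1 ≤ J′ ≤ nScales β + 1`):
  `klLevNormOf … J′ (m+1) 𝒱_0 Ωe ≤ C_m·(2^{J′})^{(m+1) − max(levelCount Ωe, 1) − 2}·N₀` for `levelCount Ωe + 6 ≤ m + 1` — the `k′ = 0` summand of
  `klTowerMeasLev_le_remeasured_sum` with growth `N^{L−3}` (plain) / `N^{L−F−2}` (level `F`), the shape UV-REMEASURE-COUNT §2 shows closes against `g^{(p−2)k}`.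
The bound is ABSOLUTE in `J′` (not relative to `k`): it is meant for the scale-`0` summand; the increments `Δ_{k′}`, `k′ ≥ 1`, keep the relative rows.
Everything is proved; no definitions; nothing about the model is asserted; nothing asserts superconductivity; the dimensionless dictionary is E1's (I6)/(I7).
References: BGM 2006 §2.8 (2.76), (2.82)–(2.84), (2.88)–(2.90), App. A3 Lemma A3.1 [cite: BenfattoGiulianiMastropietro2006]; BGM 2003 §3.1 Lemma 3.1 (4.3)
[cite: BenfattoGiulianiMastropietro2003].
-/

noncomputable section

namespace Summit.HubbardSuperconductivity.HubbardSuperconductivity.Theorems.EngineV8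

set_option linter.dupNamespace false -- summit = problem name (single-conjunct summit), D-0017

open Classical
open Real Finset Literature.MathematicalPhysics.QuantumLattice Literature.Probability.LatticeModels GrassmannAlgebra
open Literature.MathematicalPhysics.QuantumLattice.FermiRG
open Summit.HubbardSuperconductivity.HubbardSuperconductivity.Theorems.KLRegimeSplit
open Summit.HubbardSuperconductivity.HubbardSuperconductivity.Theorems.KLProgrammeLegKernels
open Summit.HubbardSuperconductivity.HubbardSuperconductivity.Theorems.DispersionFlow
open Summit.HubbardSuperconductivity.HubbardSuperconductivity.Theorems.KLRegimeWick
open Summit.HubbardSuperconductivity.HubbardSuperconductivity.Theorems.TorusFourierL2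
open Summit.HubbardSuperconductivity.HubbardSuperconductivity.Theorems.PerturbedFermiCurve

variable {L M : ℕ} [NeZero L] [NeZero M]

/-! ## §1 The count arithmetic with the second conservation gain -/

omit [NeZero L] [NeZero M] in
/-- **The count arithmetic, absolute form**: for `max(F,1) ≤ e ≤ m + 1`, `0 ≤ D`:
`27^e · (D^{m+1} · (2^{J′})^{(m+1)−e−2}) ≤ D^{m+1} · 27^{m+1} · (2^{J′})^{(m+1) − max(F,1) − 2}`. -/
theorem legSet_count_arith_abs {D : ℝ} (hD : 0 ≤ D) (J' m F e : ℕ) (hFe : max F 1 ≤ e) (he : e ≤ m + 1) :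
    (27 : ℝ) ^ e * (D ^ (m + 1) * ((2 : ℝ) ^ J') ^ ((m + 1) - e - 2)) ≤
      D ^ (m + 1) * 27 ^ (m + 1) * ((2 : ℝ) ^ J') ^ ((m + 1) - max F 1 - 2) := by
  have h27 : (27 : ℝ) ^ e ≤ 27 ^ (m + 1) := pow_le_pow_right₀ (by norm_num) he
  have h2 : ((2 : ℝ) ^ J') ^ ((m + 1) - e - 2) ≤ ((2 : ℝ) ^ J') ^ ((m + 1) - max F 1 - 2) :=
    pow_le_pow_right₀ (one_le_pow₀ (by norm_num)) (by omega)
  calc (27 : ℝ) ^ e * (D ^ (m + 1) * ((2 : ℝ) ^ J') ^ ((m + 1) - e - 2))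
      = D ^ (m + 1) * 27 ^ e * ((2 : ℝ) ^ J') ^ ((m + 1) - e - 2) := by ring
    _ ≤ D ^ (m + 1) * 27 ^ (m + 1) * ((2 : ℝ) ^ J') ^ ((m + 1) - max F 1 - 2) :=
        mul_le_mul (mul_le_mul_of_nonneg_left h27 (by positivity)) h2 (by positivity) (by positivity)

omit [NeZero L] [NeZero M] in
/-- The leg set «prescribed legs of `Ωe` together with the pinned leg `p`» has at least `max (levelCount Ωe) 1` elements. -/
theorem max_levelCount_one_le_card_legSet {m N : ℕ} (Ωe : Fin (m + 1) → Option (SectorLeg N)) (p : Fin (m + 1)) :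
    max (levelCount Ωe) 1 ≤ (univ.filter fun i : Fin (m + 1) => (Ωe i).isSome ∨ i = p).card := by
  refine max_le (levelCount_le_card_legSet Ωe p) ?_
  rw [Nat.one_le_iff_ne_zero, ← Nat.pos_iff_ne_zero, card_pos]
  exact ⟨p, by simp⟩

/-! ## §2 The jump at abstract overlap constants, absolute count -/

/-- **THE LEVELLED JUMP at abstract constants WITH THE ABSOLUTE COUNT** (BGM 2006 (2.82)–(2.84), (2.88)–(2.90); BGM 2003 Lemma 3.1).  As
`klLevNormOf_jump_le_of_consts`, with the counting hypothesis replaced by the absolute count with the second conservation gain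
(`#{…} ≤ D^{m+1}·(2^{J′})^{(m+1)−|E|−2}` for `|E| + 5 ≤ m + 1`): for `levelCount Ωe + 6 ≤ m + 1`,
`klLevNormOf … J′ (m+1) T Ωe ≤ c₁^m·c₁r·ε^{m+1}·(D^{m+1}·27^{m+1})·(2^{J′})^{(m+1) − max(levelCount Ωe, 1) − 2}·N`.
[cite: BenfattoGiulianiMastropietro2006, §2.8 (2.82)-(2.84), (2.88)-(2.90); BenfattoGiulianiMastropietro2003, §3.1 Lemma 3.1 (4.3)] -/
theorem klLevNormOf_jump_le_of_consts_abs {β : ℝ} (hβ : 0 < β) (μ : ℝ) (K : TrigPolyC4v) {k J' : ℕ} (hJ : k + 1 ≤ J')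
    (T : HubbardGrassmann L M)
    (hT : ∀ (m : ℕ) (X : Fin m → HubbardFieldIdx L M), ∑ i, signedMomentum L (X i).2 (X i).1.1.2 ≠ 0 → kernel ℂ T m X = 0)
    {c₁ c₁r D : ℝ} (hc₁0 : 0 ≤ c₁) (hc₁r0 : 0 ≤ c₁r) (hD : 0 ≤ D)
    (hcol₁ : ∀ (ω'' : Fin (sectorCount J')) (ω' : Fin (sectorCount k)) (σ c : Fin 2) (x' : SpaceTimeIdx L M),
      ∑ x'' : SpaceTimeIdx L M, ‖(sectorAnalysisMatrix L M β (klAnisoFamily L M β μ K klE0 J') *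
        sectorSubMatrix L M β (bgmFatMultiplier L M klE0 β (nambuXiCT L μ K) k)) (x'', ((ω'', σ), c)) (x', ((ω', σ), c))‖ ≤ c₁)
    (hrow₁ : ∀ (ω'' : Fin (sectorCount J')) (ω' : Fin (sectorCount k)) (σ c : Fin 2) (x'' : SpaceTimeIdx L M),
      ∑ x' : SpaceTimeIdx L M, ‖(sectorAnalysisMatrix L M β (klAnisoFamily L M β μ K klE0 J') *
        sectorSubMatrix L M β (bgmFatMultiplier L M klE0 β (nambuXiCT L μ K) k)) (x'', ((ω'', σ), c)) (x', ((ω', σ), c))‖ ≤ c₁r)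
    (m : ℕ)
    (hcnt : ∀ (E : Finset (Fin (m + 1))) (τ'' : Fin (m + 1) → SectorLeg (sectorCount J'))
      (σ' : Fin (m + 1) → SectorLeg (sectorCount k)), E.card + 5 ≤ m + 1 →
      ((((bgmSectorSet L M (klAnisoFamily L M β μ K klE0 J') (m + 1)).filter fun σ'' => (∀ e ∈ E, σ'' e = τ'' e) ∧ ∀ i,
        (∃ q : FreqMomentum L M, klAnisoFamily L M β μ K klE0 J' (σ'' i).1.1 q ≠ 0 ∧
          bgmFatMultiplier L M klE0 β (nambuXiCT L μ K) k (σ' i).1.1 q ≠ 0) ∧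
        (σ' i).1.2 = (σ'' i).1.2 ∧ (σ' i).2 = (σ'' i).2).card : ℝ)) ≤
        D ^ (m + 1) * ((2 : ℝ) ^ J') ^ ((m + 1) - E.card - 2))
    (Ωe : Fin (m + 1) → Option (SectorLeg (sectorCount J'))) (hlev : levelCount Ωe + 6 ≤ m + 1) {N : ℝ} (hN0 : 0 ≤ N)
    (hN : ∀ Ωe' : Fin (m + 1) → Option (SectorLeg (sectorCount k)), levelCount Ωe' = levelCount Ωe →
      klLevNormOf L M β μ K k (m + 1) T Ωe' ≤ N) :
    klLevNormOf L M β μ K J' (m + 1) T Ωe ≤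
      c₁ ^ m * c₁r * imagTimeWeight β M ^ (m + 1) * (D ^ (m + 1) * 27 ^ (m + 1)) *
        ((2 : ℝ) ^ J') ^ ((m + 1) - max (levelCount Ωe) 1 - 2) * N := by
  have hε0 : 0 ≤ imagTimeWeight β M := imagTimeWeight_nonneg hβ.le M
  set ε := imagTimeWeight β M with hεdef
  set F' := klAnisoFamily L M β μ K klE0 J' with hF'
  set Fk := klAnisoFamily L M β μ K klE0 k with hFk
  have hC : 0 ≤ c₁ ^ m * c₁r * ε ^ (m + 1) * (D ^ (m + 1) * 27 ^ (m + 1)) * ((2 : ℝ) ^ J') ^ ((m + 1) - max (levelCount Ωe) 1 - 2) * N := by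
    positivity
  rw [klLevNormOf, hubbardSectorKernelNorm_def]
  refine sectorisedKernelNorm_le_of_forall_le hC fun p s x => ?_
  -- the leg set and the fine prescription read by the leg sum at `(p, s)`
  set E : Finset (Fin (m + 1)) := univ.filter fun i => (Ωe i).isSome ∨ i = p with hE
  set τ'' : Fin (m + 1) → SectorLeg (sectorCount J') := fun i => (Ωe i).getD s with hτ''
  have hpE : p ∈ E := by simp [hE]
  have hEcard : E.card + 5 ≤ m + 1 := by
    have h' : E.card ≤ levelCount Ωe + 1 := card_legSet_le_levelCount_succ Ωe p
    omega
  -- (1) the leg sum is dominated by the `E`-prescribed fine sum over `bgmSectorSet`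
  have h1 : sectorLegSum ε (prescribedTuples (bgmSectorSet L M F' (m + 1)) Ωe) (sectorisedKernel L M β F' T (m + 1)) p s x ≤
      ε ^ m * ∑ σ'' ∈ (bgmSectorSet L M F' (m + 1)).filter (fun σ'' => ∀ e ∈ E, σ'' e = τ'' e),
        ∑ x'' ∈ univ.filter (fun x'' : Fin (m + 1) → SpaceTimeIdx L M => x'' p = x),
          ‖sectorisedKernel L M β F' T (m + 1) σ'' x''‖ := by
    rw [sectorLegSum_def, ← mul_sum]
    refine mul_le_mul_of_nonneg_left (sum_le_sum_of_subset_of_nonneg ?_ fun _ _ _ => sum_nonneg fun _ _ => norm_nonneg _)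
      (pow_nonneg hε0 m)
    intro Ω hΩ
    simp only [prescribedTuples, mem_filter] at hΩ ⊢
    refine ⟨hΩ.1.1, fun e he => ?_⟩
    have he' : (Ωe e).isSome ∨ e = p := by simpa [hE] using he
    rcases he' with he' | rfl
    · obtain ⟨ℓ, hℓ⟩ := Option.isSome_iff_exists.1 he'
      rw [hτ'']
      simp only [hℓ, Option.getD_some]
      exact hΩ.1.2 e ℓ (by simp [hℓ])
    · show Ω e = (Ωe e).getD s
      rcases hcase : Ωe e with _ | ℓ
      · simpa using hΩ.2
      · simp only [Option.getD_some]
        exact hΩ.1.2 e ℓ (by simp [hcase])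
  -- (2) the coarse `E`-prescribed sums are dominated by the coarse levelled norms of the same level
  have hN₁ : ∀ (τ' : Fin (m + 1) → SectorLeg (sectorCount k)) (y : SpaceTimeIdx L M),
      ε ^ m * ∑ σ' ∈ univ.filter (fun σ' : Fin (m + 1) → SectorLeg (sectorCount k) => ∀ e ∈ E, σ' e = τ' e),
        ∑ x' ∈ univ.filter (fun x' : Fin (m + 1) → SpaceTimeIdx L M => x' p = y),
          ‖sectorisedKernel L M β Fk T (m + 1) σ' x'‖ ≤ N := by
    intro τ' y
    set Ωe' : Fin (m + 1) → Option (SectorLeg (sectorCount k)) := fun i => (Ωe i).map fun _ => τ' i with hΩe'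
    have hlev' : levelCount Ωe' = levelCount Ωe := levelCount_map_const Ωe τ'
    have hle : ε ^ m * ∑ σ' ∈ univ.filter (fun σ' : Fin (m + 1) → SectorLeg (sectorCount k) => ∀ e ∈ E, σ' e = τ' e),
        ∑ x' ∈ univ.filter (fun x' : Fin (m + 1) → SpaceTimeIdx L M => x' p = y), ‖sectorisedKernel L M β Fk T (m + 1) σ' x'‖ ≤
        sectorLegSum ε (prescribedTuples (bgmSectorSet L M Fk (m + 1)) Ωe') (sectorisedKernel L M β Fk T (m + 1)) p (τ' p) y := by
      rw [sectorLegSum_def, ← mul_sum]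
      refine mul_le_mul_of_nonneg_left ?_ (pow_nonneg hε0 m)
      have hsub : (bgmSectorSet L M Fk (m + 1)).filter (fun σ' : Fin (m + 1) → SectorLeg (sectorCount k) => ∀ e ∈ E, σ' e = τ' e) ⊆
          univ.filter (fun σ' : Fin (m + 1) → SectorLeg (sectorCount k) => ∀ e ∈ E, σ' e = τ' e) :=
        filter_subset_filter _ (subset_univ _)
      rw [← Finset.sum_subset hsub ?_]
      · refine sum_le_sum_of_subset_of_nonneg ?_ fun _ _ _ => sum_nonneg fun _ _ => norm_nonneg _
        intro σ' hσ'
        simp only [mem_filter, prescribedTuples] at hσ' ⊢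
        refine ⟨⟨hσ'.1, fun i ℓ hℓ => ?_⟩, hσ'.2 p hpE⟩
        have hi : (Ωe i).isSome := by
          rcases hcase : Ωe i with _ | ℓ₀
          · simp [hΩe', hcase] at hℓ
          · simp
        have hℓ' : ℓ = τ' i := by
          obtain ⟨ℓ₀, hℓ₀⟩ := Option.isSome_iff_exists.1 hi
          simp [hΩe', hℓ₀] at hℓ
          exact hℓ.symm
        rw [hℓ']
        exact hσ'.2 i (by simp [hE, hi])
      · intro σ' hσ'univ hσ'not
        have hP := (mem_filter.1 hσ'univ).2
        have hnot : σ' ∉ bgmSectorSet L M Fk (m + 1) := fun h => hσ'not (mem_filter.2 ⟨h, hP⟩)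
        exact sum_eq_zero fun x' _ => by rw [sectorisedKernel_eq_zero_of_not_mem_bgmSectorSet β Fk T hT hnot x', norm_zero]
    refine hle.trans ((sectorLegSum_le_sectorisedKernelNorm ε _ _ p (τ' p) y).trans ?_)
    have h := hN Ωe' hlev'
    rwa [klLevNormOf, hubbardSectorKernelNorm_def] at h
  -- (3) the re-sectorisation lemma with the empty on-class set and the absolute count
  have hX0 : (0 : ℝ) ≤ D ^ (m + 1) * ((2 : ℝ) ^ J') ^ ((m + 1) - E.card - 2) := by positivity
  have h2 := hubbardSectorPrescribedSum_klAniso_jump_le_split (L := L) (M := M) hβ μ K hJ T hc₁0 hc₁r0 hX0 le_rfl hN0 le_rfl hcol₁ hrow₁ m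
    (bgmSectorSet L M F' (m + 1)) ∅ E τ'' p hpE (fun σ' _ => hcnt E τ'' σ' hEcard) (fun σ' h => absurd h (Finset.notMem_empty _)) hN₁
    (fun τ' y => by simp) x
  -- (4) assemble
  refine h1.trans (h2.trans ?_)
  rw [zero_mul, add_zero]
  have harith := legSet_count_arith_abs hD J' m (levelCount Ωe) E.card (max_levelCount_one_le_card_legSet Ωe p) (card_legSet_le_succ Ωe p)
  have hrest : 0 ≤ c₁ ^ m * c₁r * ε ^ (m + 1) * N := by positivity
  calc c₁ ^ m * c₁r * (27 : ℝ) ^ E.card * ε ^ m * (ε * (D ^ (m + 1) * ((2 : ℝ) ^ J') ^ ((m + 1) - E.card - 2) * N))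
      = (c₁ ^ m * c₁r * ε ^ (m + 1) * N) * ((27 : ℝ) ^ E.card * (D ^ (m + 1) * ((2 : ℝ) ^ J') ^ ((m + 1) - E.card - 2))) := by ring
    _ ≤ (c₁ ^ m * c₁r * ε ^ (m + 1) * N) * (D ^ (m + 1) * 27 ^ (m + 1) * ((2 : ℝ) ^ J') ^ ((m + 1) - max (levelCount Ωe) 1 - 2)) :=
        mul_le_mul_of_nonneg_left harith hrest
    _ = c₁ ^ m * c₁r * ε ^ (m + 1) * (D ^ (m + 1) * 27 ^ (m + 1)) * ((2 : ℝ) ^ J') ^ ((m + 1) - max (levelCount Ωe) 1 - 2) * N := by ring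

/-! ## §3 The jump under the stub binders, constants discharged -/

/-- **THE LEVELLED JUMP WITH THE SECOND CONSERVATION GAIN IN THE KL REGIME, constants discharged** — under the binders of `stub_engine_step_norms` plus the
count's thresholds `c ≤ c₃′(R)`, `U ≤ U₀′(R)`: for every number of legs `m + 1` there is `C_m > 0` such that for every momentum-conserving `T`, scales
`k + 1 ≤ J′ ≤ nScales β + 1`, prescription `Ωe` with `levelCount Ωe + 6 ≤ m + 1` and bound `N` of the coarse levelled norms of the same level,
`klLevNormOf … J′ (m+1) T Ωe ≤ C_m·(2^{J′})^{(m+1) − max(levelCount Ωe, 1) − 2}·N` (ABSOLUTE in `J′`).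
[cite: BenfattoGiulianiMastropietro2006, §2.8 (2.82)-(2.84), (2.88)-(2.90); BenfattoGiulianiMastropietro2003, §3.1 Lemma 3.1 (4.3)] -/
theorem klLevNormOf_jump_le_klEng_abs (m : ℕ) :
    ∃ C : ℝ, 0 < C ∧ ∀ R : RenConsts, R.WF2 → ∃ c₃' : ℝ, 0 < c₃' ∧ ∃ U₀' : ℝ, 0 < U₀' ∧
      ∀ (P : SplitConsts) (c : ℝ), P.WF → 0 < c → c ≤ klEngC₃6 P R → c ≤ c₃' →
      ∀ μ ∈ klWindowC, ∀ U : ℝ, 0 < U → U ≤ klEngU₀9 P R c → U ≤ U₀' → ∀ β : ℝ, klBetaMin ≤ β → β ≤ Real.exp (c / U ^ 2) →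
      ∀ K : TrigPolyC4v, FrameOK R U (nScales β) μ K → ∀ (L M : ℕ) [NeZero L] [NeZero M],
      klEngL₃ β U ≤ L → klEngM₃ β U L ≤ M → ∀ k J' : ℕ, k + 1 ≤ J' → J' ≤ nScales β + 1 →
      ∀ T : HubbardGrassmann L M,
        (∀ (m' : ℕ) (X : Fin m' → HubbardFieldIdx L M), ∑ i, signedMomentum L (X i).2 (X i).1.1.2 ≠ 0 → kernel ℂ T m' X = 0) →
      ∀ (Ωe : Fin (m + 1) → Option (SectorLeg (sectorCount J'))), levelCount Ωe + 6 ≤ m + 1 → ∀ (N : ℝ), 0 ≤ N →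
        (∀ Ωe' : Fin (m + 1) → Option (SectorLeg (sectorCount k)), levelCount Ωe' = levelCount Ωe →
          klLevNormOf L M β μ K k (m + 1) T Ωe' ≤ N) →
        klLevNormOf L M β μ K J' (m + 1) T Ωe ≤ C * ((2 : ℝ) ^ J') ^ ((m + 1) - max (levelCount Ωe) 1 - 2) * N := by
  obtain ⟨CJ, hCJ, hov⟩ := overlap_jump_sums_klEng
  obtain ⟨D, hD, hreg⟩ := card_relCount_prescribed_absUmklapp_klAniso_le_window
  refine ⟨(3 * CJ / 2) ^ (m + 1) * (D ^ (m + 1) * 27 ^ (m + 1)), by positivity, fun R hR2 => ?_⟩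
  have hRj : ∀ j, 0 ≤ R.Gfr j := gfr_nonneg_of_wf2 hR2
  obtain ⟨c₃, hc₃, U₀, hU₀, hcnt⟩ := hreg R hRj
  refine ⟨c₃, hc₃, U₀, hU₀, ?_⟩
  intro P c hP hc hc6 hc₃' μ hμ U hU hU9 hU₀' β hβmin hβc K hK L M _ _ hL3 hM3 k J' hJ hJN T hT Ωe hlev N hN0 hN
  have hβ : 0 < β := KLRegimeSplit.pos_of_klBetaMin_le hβmin
  obtain ⟨_, hcol₁, hrow₁⟩ := hov P R c hP hR2 hc hc6 μ hμ U hU hU9 β hβmin hβc K hK L M hL3 hM3 k J' hJ hJN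
  have hc₁0 : (0 : ℝ) ≤ 3 * CJ * M / β := by positivity
  have h := klLevNormOf_jump_le_of_consts_abs hβ μ K hJ T hT hc₁0 hc₁0 hD.le hcol₁ hrow₁ m
    (fun E τ'' σ' hE => hcnt c hc hc₃' U hU hU₀' β hβmin hβc μ hμ μ K hK L M m k J' _ subset_rfl E τ'' σ' hE) Ωe hlev hN0 hN
  have hMne : (M : ℝ) ≠ 0 := by exact_mod_cast NeZero.ne M
  have hεc : imagTimeWeight β M * (3 * CJ * M / β) = 3 * CJ / 2 := by
    unfold imagTimeWeight; field_simp
  have hconst : (3 * CJ * M / β) ^ m * (3 * CJ * M / β) * imagTimeWeight β M ^ (m + 1) = (3 * CJ / 2) ^ (m + 1) := by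
    rw [← pow_succ, ← mul_pow, mul_comm (3 * CJ * M / β), hεc]
  calc klLevNormOf L M β μ K J' (m + 1) T Ωe
      ≤ (3 * CJ * M / β) ^ m * (3 * CJ * M / β) * imagTimeWeight β M ^ (m + 1) * (D ^ (m + 1) * 27 ^ (m + 1)) *
          ((2 : ℝ) ^ J') ^ ((m + 1) - max (levelCount Ωe) 1 - 2) * N := h
    _ = (3 * CJ / 2) ^ (m + 1) * (D ^ (m + 1) * 27 ^ (m + 1)) * ((2 : ℝ) ^ J') ^ ((m + 1) - max (levelCount Ωe) 1 - 2) * N := by rw [hconst]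

/-! ## §4 The scale-`0` action re-measured at `F_{J′}` with the second conservation gain -/

/-- **THE SCALE-`0` ACTION `𝒱_0[K]` RE-MEASURED AT `F_{J′}` WITH THE SECOND CONSERVATION GAIN** (`1 ≤ J′ ≤ nScales β + 1`): at every prescription `Ωe` with
`levelCount Ωe + 6 ≤ m + 1`, `klLevNormOf … J′ (m+1) 𝒱_0 Ωe ≤ C_m·(2^{J′})^{(m+1) − max(levelCount Ωe, 1) − 2}·N₀` whenever the level-`0` carriers
`klAnisoLegKernelNormAt … klE0 0 (m+1) Ωe′` of the same level are `≤ N₀` — the UV summand of `klTowerMeasLev_le_remeasured_sum` with growth `N^{L−3}` (plain norm)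
/ `N^{L−F−2}` (level `F ≥ 1`); its supplier is the level-`0` law. [cite: BenfattoGiulianiMastropietro2006, §2.8 (2.82)-(2.84); BenfattoGiulianiMastropietro2003, §3.1 Lemma 3.1 (4.3)] -/
theorem klLevNormOf_scaleZero_remeasure_le_klEng_abs (m : ℕ) :
    ∃ C : ℝ, 0 < C ∧ ∀ R : RenConsts, R.WF2 → ∃ c₃' : ℝ, 0 < c₃' ∧ ∃ U₀' : ℝ, 0 < U₀' ∧
      ∀ (P : SplitConsts) (c : ℝ), P.WF → 0 < c → c ≤ klEngC₃6 P R → c ≤ c₃' →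
      ∀ μ ∈ klWindowC, ∀ U : ℝ, 0 < U → U ≤ klEngU₀9 P R c → U ≤ U₀' → ∀ β : ℝ, klBetaMin ≤ β → β ≤ Real.exp (c / U ^ 2) →
      ∀ K : TrigPolyC4v, FrameOK R U (nScales β) μ K → ∀ (L M : ℕ) [NeZero L] [NeZero M],
      klEngL₃ β U ≤ L → klEngM₃ β U L ≤ M → ∀ J' : ℕ, 1 ≤ J' → J' ≤ nScales β + 1 →
      ∀ (Ωe : Fin (m + 1) → Option (SectorLeg (sectorCount J'))), levelCount Ωe + 6 ≤ m + 1 → ∀ (N₀ : ℝ), 0 ≤ N₀ →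
        (∀ Ωe' : Fin (m + 1) → Option (SectorLeg (sectorCount 0)), levelCount Ωe' = levelCount Ωe →
          klAnisoLegKernelNormAt L M β U μ K klE0 0 (m + 1) Ωe' ≤ N₀) →
        klLevNormOf L M β μ K J' (m + 1) (klEffectiveAction L M β U μ K klE0 0) Ωe ≤
          C * ((2 : ℝ) ^ J') ^ ((m + 1) - max (levelCount Ωe) 1 - 2) * N₀ := by
  obtain ⟨C, hC, h⟩ := klLevNormOf_jump_le_klEng_abs m
  refine ⟨C, hC, fun R hR2 => ?_⟩
  obtain ⟨c₃, hc₃, U₀, hU₀, h'⟩ := h R hR2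
  refine ⟨c₃, hc₃, U₀, hU₀, ?_⟩
  intro P c hP hc hc6 hc₃' μ hμ U hU hU9 hU₀' β hβmin hβc K hK L M _ _ hL3 hM3 J' hJ1 hJN Ωe hlev N₀ hN0 hN
  exact h' P c hP hc hc6 hc₃' μ hμ U hU hU9 hU₀' β hβmin hβc K hK L M hL3 hM3 0 J' (by omega) hJN
    (klEffectiveAction L M β U μ K klE0 0) (klEffectiveAction_momentumConserving β U μ K klE0 0) Ωe hlev N₀ hN0
    (fun Ωe' hlev' => by rw [klLevNormOf_klEffectiveAction]; exact hN Ωe' hlev')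

end Summit.HubbardSuperconductivity.HubbardSuperconductivity.Theorems.EngineV8

end
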